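import Summits.Ventures.AbcSig.Rows.StatementsC1b
import Summits.Ventures.AbcSig.Rows.Xn8Yn5Z2

/-!
# Venture AbcSig — CELL bridge for `xⁿ + 8yⁿ = 5 z²` (FAMILY C1b, `α = 3`): p1's census predicate `Rows.C1bCell 5 (fun _ α => α = 3) 7 ∅`

HONEST FRAMING. COMPUTATION cell `pub-abcsig`; CONDITIONAL theorem; no claim on ABC or any summit. Hypotheses exactly
those of `Rows/Xn8Yn5Z2.lean` (`row_Xn8Yn5Z2`): `BS04Package` (CITED), `DataComplete` at the two levels (COMPUTED, certified level
files) and the row's per-orbit CITED exclusions `hX_…`, universally quantified in the exponent. Conclusion = the conjunct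
`Rows.C1bCell 5 (fun _ α => α = 3) 7 ∅` of p1's `Rows.C1bSmallAlphaSigned` / `Rows.C1bExtSigned`
(`Rows/StatementsC1b.lean`; row of record `census/rows/C1b/C1b-C5-a3.md`, R8-signed): every prime `n ≥ 7`, `n ∤ 5`,
`α = 3`, no primitive solution with `|xy| > 1`. GENERATED by p-lean gen3/make_c1bcell.py (pattern of `Rows/Xn8Yn11Z2Cell.lean`).
-/

namespace Summit.Ventures.AbcSig

/-- `xⁿ + 8yⁿ = 5z²` (`α = 3`), every prime `n ≥ 7` with `n ∤ 5`, `|xy| > 1`: p1's conjunct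
`Rows.C1bCell 5 (fun _ α => α = 3) 7 ∅` from `row_Xn8Yn5Z2`. -/
theorem C1bCell_5_a3_of (M : NewformModel) (hP : M.BS04Package)
    (hD800 : M.DataComplete 800 level800Orbits)
    (hD50 : M.DataComplete 50 level50Orbits)
    (hX_orbit_800_1 : ∀ n : ℕ, M.Excludes 800 orbit_800_1 (famBC 3 5 n (fun _ b => ¬ 2 ∣ b)))
    (hX_orbit_800_4 : ∀ n : ℕ, M.Excludes 800 orbit_800_4 (famBC 3 5 n (fun _ b => ¬ 2 ∣ b)))
    (hX_orbit_800_5 : ∀ n : ℕ, M.Excludes 800 orbit_800_5 (famBC 3 5 n (fun _ b => ¬ 2 ∣ b)))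
    (hX_orbit_800_6 : ∀ n : ℕ, M.Excludes 800 orbit_800_6 (famBC 3 5 n (fun _ b => ¬ 2 ∣ b)))
    (hX_orbit_800_9 : ∀ n : ℕ, M.Excludes 800 orbit_800_9 (famBC 3 5 n (fun _ b => ¬ 2 ∣ b))) :
    Rows.C1bCell 5 (fun _ α => α = 3) 7 ∅ := by
  intro n hn h0 _ _ α hα x y z h1 h2
  subst hα
  exact row_Xn8Yn5Z2 M hP hD800 hD50 n hn h0 (hX_orbit_800_1 n) (hX_orbit_800_4 n) (hX_orbit_800_5 n) (hX_orbit_800_6 n) (hX_orbit_800_9 n) x y z h1 h2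

end Summit.Ventures.AbcSig
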